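import Literature.Barriers.CriticalPhenomena.SupercriticalSAWSpaceFilling
import HarnessLib

/-!
# Supercritical self-avoiding walks (Duminil-Copin–Kozma–Yadin 2014): dangling filaments of
# `Ω_δ` are deterministic holes — the scope of the printed general-domain Theorem 6

Companion of `SupercriticalSAWSpaceFilling.lean` (barrier `SupercriticalSAWSpaceFilling` =
Theorem 1 of H. Duminil-Copin, G. Kozma, A. Yadin, *Supercritical self-avoiding walks are
space-filling*, Ann. IHP Probab. Stat. 50 (2014) 315–326, arXiv:1110.3074, for the unit disk;
proved in the tree, `SupercriticalSAWSpaceFilling_holds`), written by the barrier audit of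
2026-08-15. It machine-checks the lattice-combinatorial core of the audit's remark on the SCOPE
of the printed general-domain statement (Theorem 6 of the source), over the library's own
objects (`DomainSAW`, `tube`, `holeGraph`, `HasLargeHole`) and for an ARBITRARY domain `Ω`.

## What the source prints

* §1, after Theorem 1 (p. 3): "assume that at some given scale `δ` our domain `Ω` has a part
  which is connected by a "bridge" of width `δ`. Then the graph `Ω_δ` will have a large part
  connected by a single edge, which does not leave the self-avoiding walk enough space to enter
  and exit. Thus an analog of theorem 1 will not hold for this `Ω`."
* §3, Theorem 6: "For every `x > 1/μ`, there exists `m = m(x)` and `c(x) > 0` such that for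
  every domain `Ω` and every `δ > 0` such that `𝓕(Ω_δ, m)` is connected, one has, for every `a`
  and `b` in the boundary of `Ω`, and every `λ > 0`,
  `P_{Ω_δ,a_δ,b_δ,x}(∃ a component of Ω_δ ∖ Γ_δ^{6m} of size > λ) ≤ (C(x,Ω)/δ²) e^{-c(x)λ}`",
  with, in its proof, "`C(Ω) = C(Ω,x,m)` depends on the area of `Ω`, `x` and `m`" and the step
  "there must exist a connected family of at least `s/(2m+1)²` boxes of size `2m+1` covering `S`
  and not intersecting `γ_δ`".

## What is proved here, and what it says about Theorem 6

`SupercriticalSAW.filament_notMem_support`, `SupercriticalSAW.le_length_of_walk_to_filament`,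
`SupercriticalSAW.hasLargeHole_of_filament`: let `f 1, …, f N` be a **dangling filament** of
`Ω_δ` — sites of `Ω_δ`, consecutive ones adjacent, such that for `1 ≤ j ≤ N` every neighbour
of `f j` in the graph `Ω_δ` is `f (j-1)` or (if `j < N`) `f (j+1)` (so the filament hangs off
the rest of `Ω_δ` at `f 0 ∼ f 1` and ends at `f N`). Then (i) NO self-avoiding walk of `Ω_δ`
between two sites off the filament visits it (its farthest visited filament site would be
entered and left through the same neighbour); (ii) every walk of `Ω_δ` from a site off the
filament to `f j` has length `≥ j`; hence (iii) for every such SAW `γ`, every `ξ ≤ M` and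
`M ≤ N`, the sites `f M, …, f N` lie in one component of `Ω_δ ∖ Γ_δ^ξ`, which therefore has
`≥ N + 1 - M` sites: `HasLargeHole ξ s γ` for every `s < N + 1 - M`, DETERMINISTICALLY.

This is the printed "bridge of width `δ`" remark in its one-ended form, and it shows that the
hypothesis of Theorem 6 ("`𝓕(Ω_δ, m)` is connected") does not repair it: a dangling filament
contains no `m`-box, so it neither disconnects nor otherwise affects the box family. Concretely
(on paper, audit notes): for the fixed bounded simply connected domain
`Ω = 𝔻 ∪ {1/2 < Re z < 2, |Im z| < (2 - Re z)²/10}` (the disk with an outward cusp) and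
`a, b = ±i`, the family of `m`-boxes of `Ω_δ` is connected for all small `δ` (each box slides
through boxes of `Ω_δ` towards the real axis and then leftwards into `𝔻_δ`), `Ω_δ = Ω ∩ δℤ²` is
connected, and the sites `(kδ, 0)`, `2 - √(10δ) ≤ kδ < 2`, form a dangling filament with
`N ≍ √10 · δ^{-1/2}` (their vertical neighbours violate `|Im z| < (2 - Re z)²/10 ≤ δ`, and
`Re z ≥ 2` is outside `Ω`). By (iii) with `M = 6m`, a component of `Ω_δ ∖ Γ_δ^{6m}` with
`> δ^{-1/2}` sites is present with probability one for small `δ`, whereas the printed bound at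
`λ = δ^{-1/2}` is `(C(x,Ω)/δ²) e^{-c(x) δ^{-1/2}} → 0`. So Theorem 6 is false as literally
printed for general `Ω`; the faulty step is the covering sentence quoted above (sites of `Ω_δ`
lying in no `m`-box are ignored). Theorem 1 (the disk; the barrier) and Theorem 2 (domains
expanded by `ξδ`, which thickens every filament to width `≥ 2ξ ⊇` boxes) are not affected; the
tree's proof of the disk case (`DKY2014_thm6_disk_holds`, `…TilesTheorem6.lean`) uses the tube
radius `xiP m 4` (a fixed multiple of the tile side, in place of the printed `6m`) together with
a separate annular sum for walks avoiding all deep tiles, and the conditional `m`-box route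
(`DKY2014_thm6_disk_of_facts`, `…Peierls.lean`) likewise uses `tubeRadius m = 16m + 15` and an
annular-walk hypothesis — both repairing the same boundary-layer step for the disk.

## References

* H. Duminil-Copin, G. Kozma, A. Yadin, *Supercritical self-avoiding walks are space-filling*,
  Ann. Inst. Henri Poincaré Probab. Stat. 50 (2014) 315–326, arXiv:1110.3074: §1 (p. 3, the
  "bridge of width δ" remark), §3 Theorem 6 and its proof (p. 6–7). [DuminilCopinKozmaYadin2014]
-/

noncomputable section

open Literature.Probability.LatticeModels Literature.Probability.RandomPlanarGeometry.SAW

namespace Literature.Barriers.CriticalPhenomena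

namespace SupercriticalSAW

variable {Ω : Set ℂ} {δ : ℝ} {a b : Site 2}

/-- **A self-avoiding walk between two sites off a dangling filament never visits it.** If for
`1 ≤ j ≤ N` every `Ω_δ`-neighbour of `f j` is `f (j-1)`, or `f (j+1)` with `j < N`, and the
endpoints `a, b` are not among `f 1, …, f N`, then no `f j`, `1 ≤ j ≤ N`, is on the walk: at the
largest such `j` the walk would arrive from and leave towards the same site `f (j-1)`.
("a large part connected by a single edge, which does not leave the self-avoiding walk enough
space to enter and exit".) [cite: DuminilCopinKozmaYadin2014, §1 (after Theorem 1)] -/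
theorem filament_notMem_support (f : ℕ → Site 2) (N : ℕ)
    (hnb : ∀ j, 1 ≤ j → j ≤ N → ∀ w, (discreteDomainGraph Ω δ).Adj (f j) w →
      w = f (j - 1) ∨ (w = f (j + 1) ∧ j < N))
    (haS : ∀ j, 1 ≤ j → j ≤ N → f j ≠ a) (hbS : ∀ j, 1 ≤ j → j ≤ N → f j ≠ b)
    (γ : DomainSAW Ω δ a b) : ∀ j, 1 ≤ j → j ≤ N → f j ∉ γ.walk.support := by
  classical
  -- suppose some filament site is visited and take the largest index `j`
  by_contra hcon
  push Not at hcon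
  set T : Finset ℕ := (Finset.Icc 1 N).filter fun j => f j ∈ γ.walk.support with hT
  have hTne : T.Nonempty := by
    obtain ⟨j, hj1, hjN, hj⟩ := hcon
    exact ⟨j, by rw [hT, Finset.mem_filter, Finset.mem_Icc]; exact ⟨⟨hj1, hjN⟩, hj⟩⟩
  set j := T.max' hTne with hj
  have hjT : j ∈ T := Finset.max'_mem T hTne
  rw [hT, Finset.mem_filter, Finset.mem_Icc] at hjT
  obtain ⟨⟨hj1, hjN⟩, hjsupp⟩ := hjT
  have hmax : ∀ i, 1 ≤ i → i ≤ N → f i ∈ γ.walk.support → i ≤ j := fun i hi1 hiN hi =>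
    Finset.le_max' T i (by rw [hT, Finset.mem_filter, Finset.mem_Icc]; exact ⟨⟨hi1, hiN⟩, hi⟩)
  -- split the walk at `w = f j`
  set p := γ.walk with hp
  have hnodup : p.support.Nodup := γ.isPath.support_nodup
  set r := p.takeUntil (f j) hjsupp with hr
  set q := p.dropUntil (f j) hjsupp with hq
  have hspec : r.append q = p := p.take_spec hjsupp
  have hsupp : p.support = r.support ++ q.support.tail := by
    rw [← SimpleGraph.Walk.support_append, hspec]
  have hdisj : r.support.Disjoint q.support.tail :=
    List.disjoint_of_nodup_append (hsupp ▸ hnodup)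
  -- the successor of `f j` on the walk is `f (j - 1)`
  obtain ⟨w₁, h₁, q', hq'⟩ := SimpleGraph.Walk.exists_eq_cons_of_ne (hbS j hj1 hjN) q
  have hw₁tail : w₁ ∈ q.support.tail := by
    rw [hq', SimpleGraph.Walk.support_cons, List.tail_cons]
    exact SimpleGraph.Walk.start_mem_support q'
  have hw₁supp : w₁ ∈ p.support := by
    rw [hsupp]; exact List.mem_append_right _ hw₁tail
  have hw₁ : w₁ = f (j - 1) := by
    rcases hnb j hj1 hjN w₁ h₁ with h | ⟨h, hjlt⟩
    · exact h
    · exact absurd (hmax (j + 1) (by omega) (by omega) (h ▸ hw₁supp)) (by omega)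
  -- the predecessor of `f j` on the walk is `f (j - 1)` as well
  obtain ⟨w₀, h₀, r', hr'⟩ :=
    SimpleGraph.Walk.exists_eq_cons_of_ne (haS j hj1 hjN) r.reverse
  have hw₀rsupp : w₀ ∈ r.support := by
    have : w₀ ∈ r.reverse.support := by
      rw [hr', SimpleGraph.Walk.support_cons]
      exact List.mem_cons_of_mem _ (SimpleGraph.Walk.start_mem_support r')
    rwa [SimpleGraph.Walk.support_reverse, List.mem_reverse] at this
  have hw₀supp : w₀ ∈ p.support := by
    rw [hsupp]; exact List.mem_append_left _ hw₀rsupp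
  have hw₀ : w₀ = f (j - 1) := by
    rcases hnb j hj1 hjN w₀ h₀ with h | ⟨h, hjlt⟩
    · exact h
    · exact absurd (hmax (j + 1) (by omega) (by omega) (h ▸ hw₀supp)) (by omega)
  -- so `f (j - 1)` occurs before and after `f j`: not a path
  exact hdisj (hw₀ ▸ hw₀rsupp) (hw₁ ▸ hw₁tail)

/-- **Walks into a dangling filament are long.** Under the same neighbour hypothesis, a walk of
`Ω_δ` from a site `w` off the filament to `f j` (`1 ≤ j ≤ N`) has length at least `j`
(induction on the length: the last step into `f j` comes from `f (j-1)` or from `f (j+1)`).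
[cite: DuminilCopinKozmaYadin2014, §1 (after Theorem 1)] -/
theorem le_length_of_walk_to_filament (f : ℕ → Site 2) (N : ℕ)
    (hnb : ∀ j, 1 ≤ j → j ≤ N → ∀ w, (discreteDomainGraph Ω δ).Adj (f j) w →
      w = f (j - 1) ∨ (w = f (j + 1) ∧ j < N))
    {w : Site 2} (hw : ∀ j, 1 ≤ j → j ≤ N → f j ≠ w) :
    ∀ (L j : ℕ), 1 ≤ j → j ≤ N → ∀ q : (discreteDomainGraph Ω δ).Walk (f j) w,
      q.length = L → j ≤ L := by
  intro L
  induction L with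
  | zero =>
    intro j hj1 hjN q hq
    have := SimpleGraph.Walk.eq_of_length_eq_zero hq
    exact absurd this (hw j hj1 hjN)
  | succ L ih =>
    intro j hj1 hjN q hq
    obtain ⟨w₁, h₁, q', hq'⟩ := SimpleGraph.Walk.exists_eq_cons_of_ne (hw j hj1 hjN) q
    have hlen : q'.length = L := by
      have := congrArg SimpleGraph.Walk.length hq'
      rw [SimpleGraph.Walk.length_cons, hq] at this
      omega
    rcases hnb j hj1 hjN w₁ h₁ with h | ⟨h, hjlt⟩
    · -- the step goes to `f (j - 1)`
      rcases Nat.lt_or_ge 1 j with hj2 | hj2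
      · subst h
        have := ih (j - 1) (by omega) (by omega) q' hlen
        omega
      · omega
    · -- the step goes to `f (j + 1)`, `j < N`
      subst h
      have := ih (j + 1) (by omega) (by omega) q' hlen
      omega

/-- **Dangling filaments are deterministic holes.** Let `Ω_δ` be finite and connected (as a
graph), and let `f 1, …, f N` be a dangling filament of `Ω_δ`: sites of `Ω_δ`, pairwise
distinct, consecutive ones adjacent, every `Ω_δ`-neighbour of `f j` being `f (j-1)` or (for
`j < N`) `f (j+1)`. Then for EVERY self-avoiding walk `γ` of `Ω_δ` between sites `a, b` off the
filament, every tube radius `ξ ≤ M` (`1 ≤ M ≤ N`) and every `s < N + 1 - M`, some component of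
`Ω_δ ∖ Γ_δ^ξ` has more than `s` sites (`HasLargeHole ξ s γ`): the sites `f M, …, f N` are at
graph distance `≥ M ≥ ξ` from the walk (`filament_notMem_support`,
`le_length_of_walk_to_filament`) and are joined to each other off the tube. With the cusp domain
of the module docstring (`N ≍ δ^{-1/2}`, `M = 6m`) this exhibits, with probability one, a
component of `Ω_δ ∖ Γ_δ^{6m}` larger than `δ^{-1/2}` in a domain whose `m`-box family is
connected — so the printed general-domain Theorem 6, whose bound at `λ = δ^{-1/2}` tends to `0`,
does not hold as literally stated (Theorem 1, the disk, is unaffected).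
[cite: DuminilCopinKozmaYadin2014, Theorem 6 and §3 (proof of Theorem 6)] -/
theorem hasLargeHole_of_filament (hfin : (meshDomain Ω δ).Finite)
    (hconn : ∀ u ∈ meshDomain Ω δ, ∀ v ∈ meshDomain Ω δ, (discreteDomainGraph Ω δ).Reachable u v)
    (f : ℕ → Site 2) (N : ℕ) (hmem : ∀ j, 1 ≤ j → j ≤ N → f j ∈ meshDomain Ω δ)
    (hadj : ∀ j, 1 ≤ j → j < N → (discreteDomainGraph Ω δ).Adj (f j) (f (j + 1)))
    (hinj : ∀ i j, 1 ≤ i → i ≤ N → 1 ≤ j → j ≤ N → f i = f j → i = j)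
    (hnb : ∀ j, 1 ≤ j → j ≤ N → ∀ w, (discreteDomainGraph Ω δ).Adj (f j) w →
      w = f (j - 1) ∨ (w = f (j + 1) ∧ j < N))
    (ha : a ∈ meshDomain Ω δ) (haS : ∀ j, 1 ≤ j → j ≤ N → f j ≠ a)
    (hbS : ∀ j, 1 ≤ j → j ≤ N → f j ≠ b) {ξ s : ℝ} (M : ℕ) (hM1 : 1 ≤ M) (hξM : ξ ≤ M)
    (hMN : M ≤ N) (hs : s < ((N + 1 - M : ℕ) : ℝ)) (γ : DomainSAW Ω δ a b) :
    HasLargeHole ξ s γ := by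
  classical
  -- the walk stays in `Ω_δ` and off the filament
  have hsuppD : ∀ u ∈ γ.walk.support, u ∈ meshDomain Ω δ := by
    have key : ∀ {u v : Site 2} (p : (discreteDomainGraph Ω δ).Walk u v),
        u ∈ meshDomain Ω δ → ∀ w ∈ p.support, w ∈ meshDomain Ω δ := by
      intro u v p
      induction p with
      | nil =>
        intro hu w hw
        rw [SimpleGraph.Walk.support_nil, List.mem_singleton] at hw
        exact hw ▸ hu
      | cons h p ih =>
        intro hu w hw
        rw [SimpleGraph.Walk.support_cons, List.mem_cons] at hw
        rcases hw with rfl | hw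
        · exact hu
        · exact ih (discreteDomainGraph_adj_iff.1 h).2.2 w hw
    exact key γ.walk ha
  have havoid := filament_notMem_support f N hnb haS hbS γ
  -- the sites `f j`, `M ≤ j ≤ N`, are off the tube
  have hnot : ∀ j, M ≤ j → j ≤ N → f j ∉ tube ξ γ := by
    rintro j hjM hjN ⟨-, u, hu, hdist⟩
    have huS : ∀ i, 1 ≤ i → i ≤ N → f i ≠ u := fun i hi1 hiN h => havoid i hi1 hiN (h ▸ hu)
    have hreach : (discreteDomainGraph Ω δ).Reachable (f j) u :=
      hconn _ (hmem j (by omega) hjN) _ (hsuppD u hu)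
    obtain ⟨q, hq⟩ := hreach.exists_walk_length_eq_dist
    have hle : j ≤ (discreteDomainGraph Ω δ).dist (f j) u :=
      hq ▸ le_length_of_walk_to_filament f N hnb huS q.length j (by omega) hjN q rfl
    have hle' : (M : ℝ) ≤ (discreteDomainGraph Ω δ).dist u (f j) := by
      rw [SimpleGraph.dist_comm]
      exact_mod_cast hjM.trans hle
    linarith
  have hmemH : ∀ j, M ≤ j → j ≤ N → f j ∈ meshDomain Ω δ \ tube ξ γ := fun j hjM hjN =>
    ⟨hmem j (by omega) hjN, hnot j hjM hjN⟩
  -- as vertices of the hole graph: `g i = f (M + i)`, `i ≤ N - M`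
  let g : ℕ → ↥(meshDomain Ω δ \ tube ξ γ) := fun i =>
    if hi : M + i ≤ N then ⟨f (M + i), hmemH (M + i) (by omega) hi⟩
    else ⟨f M, hmemH M le_rfl hMN⟩
  have hg : ∀ i, M + i ≤ N → (g i : Site 2) = f (M + i) := fun i hi => by
    simp only [g, dif_pos hi]
  have hgadj : ∀ i, M + (i + 1) ≤ N → (holeGraph ξ γ).Adj (g i) (g (i + 1)) := fun i hi => by
    refine SimpleGraph.induce_adj.2 ?_
    rw [hg i (by omega), hg (i + 1) hi, show M + (i + 1) = M + i + 1 by ring]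
    exact hadj (M + i) (by omega) (by omega)
  have hgreach : ∀ i, M + i ≤ N → (holeGraph ξ γ).Reachable (g 0) (g i) := by
    intro i
    induction i with
    | zero => exact fun _ => SimpleGraph.Reachable.refl _
    | succ i ih => exact fun hi => (ih (by omega)).trans (hgadj i hi).reachable
  set C : (holeGraph ξ γ).ConnectedComponent := (holeGraph ξ γ).connectedComponentMk (g 0)
    with hC
  have hsupp : ∀ i < N + 1 - M, g i ∈ C.supp := fun i hi => by
    rw [SimpleGraph.ConnectedComponent.mem_supp_iff, hC]
    exact SimpleGraph.ConnectedComponent.sound (hgreach i (by omega)).symm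
  haveI : Finite ↥(meshDomain Ω δ \ tube ξ γ) := (hfin.subset fun _ h => h.1).to_subtype
  have hginj : ∀ i < N + 1 - M, ∀ i' < N + 1 - M, g i = g i' → i = i' := by
    intro i hi i' hi' hii'
    have h := congrArg (fun v : ↥(meshDomain Ω δ \ tube ξ γ) => (v : Site 2)) hii'
    simp only [hg i (by omega), hg i' (by omega)] at h
    have := hinj (M + i) (M + i') (by omega) (by omega) (by omega) (by omega) h
    omega
  have hcard : N + 1 - M ≤ C.supp.ncard :=
    Set.le_ncard_of_inj_on_range g hsupp hginj (Set.toFinite _)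
  refine ⟨C, hs.trans_le ?_⟩
  exact_mod_cast hcard

end SupercriticalSAW

end Literature.Barriers.CriticalPhenomena
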